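import Mathlib.Algebra.BigOperators.Intervals
import Mathlib.Algebra.Ring.Parity
import Mathlib.Data.Complex.Basic
import Mathlib.Tactic.Ring
import Mathlib.Tactic.LinearCombination
import Mathlib.Tactic.IntervalCases
import HarnessLib

/-!
# R90 · S6 — CARD E1-ARITH «THE TWO-STEP RECURSION BEHIND THE TYPE-(1) ELLIPTIC IDENTITY» (`Theorems/R90S6EllipticIdentityTwoStepRecursion.lean`)

Cell `hodgecm-mathlib`, crux H413 (`stmt-HodgeConjecture-24833`), route of record `HCCMUnconditional`; programme R90-TF, section S6 (base `R90-C14`), hand K2E3-p21 (g9)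
(cross-line valve; card dealt by R90-C14-plan (g2), R90 bus 2026-09-05T02:12:26Z, head bytes of record).  Helper lane `--supports stmt-HodgeConjecture-24833 --as helper`;
THEOREMS ONLY (no definition, no instance, no notation, no named fact, no `sorry`); imports Mathlib pieces + HarnessLib only (no tree file is needed — every displayed
expression is BYTE-SHAPED on ★ `Theorems/R90S6HSideEllipticValueClosed.lean` :53–:55 (the H-side closed form `RHS(m)` in `(q, F₀, N₀, N₁)`) and on K2E3-p28 (g4)'s
G3-NUMBERS display `(if Even m then (q:ℂ)^(2*m-3) * ↑N′₁ else (q:ℂ)^(2*(m-1)) * ↑N′₀)`).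

THE MATHEMATICS (row E1.3.5.2.6, type (1), the «(E1′) ∀ m ≥ 1 ⟸ anchors m = 1, 2 + first-shell balance D = 0» step of typ1 (g3)'s (E1) sheet v1.1 :203–:317).
With `N_{[k]} := N₁` for `k` even, `N₀` for `k` odd, the H-side closed form is
`RHS(m) = (q²−1) q^{2(m−1)} F₀ + (q²−1) q^{2m−3} Σ_{k=1}^{m−1} (−1)^k N_{[k]} + (−1)^m q^{2m−1} N_{[m]}` (ℕ-truncated exponents, harmless: the middle sum is empty at `m = 1`).
(AR.0) the G-side closed value satisfies `G(m+2) = q⁴ G(m)`; (AR.1) `RHS(m+2) = q⁴ RHS(m) + (−1)^m (q²−1) q^{2m+1} (N_{[m]} − N_{[m+1]})`; (AR.2) two sequences with the same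
two-step recursion `X(m+2) = c X(m)` and the same values at `m = 1, 2` agree for all `m ≥ 1`; (AR.3) HEAD: if `G(m+2) = q⁴ G(m)`, the first-shell balance
`N₀₁ + N₀₂ = N₁₁ + N₁₂` holds and `G` agrees with `RHS₁ + RHS₂` at `m = 1, 2`, then `G(m) = RHS₁(m) + RHS₂(m)` for all `m ≥ 1` — summing (AR.1) over `j = 1, 2` the cross
term is `±(N₀₁ + N₀₂ − N₁₁ − N₁₂) = 0` for either parity of `m`.
KILL-CHECKS.  `m = 1 → 3`: `RHS(3) − q⁴ RHS(1) = (q²−1)q³(N₁ − N₀) − q⁵ N₀ + q⁴·q N₀ = −(q²−1) q³ (N₀ − N₁)` ✓ (= (AR.1) at `m = 1`); `q = 0` corner: identities of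
polynomials, harmless.
* `gClosed_two_step` (AR.0), `hClosed_two_step` (AR.1), `eq_of_two_step_rec` (AR.2), **`eq_sum_hClosed_of_anchors`** (AR.3).

HONEST LABEL: HC_CM is proved only modulo the 7 printed citations (2 remaining named inputs: hLiu418 = stmt-HodgeConjecture-24832, h413 =
stmt-HodgeConjecture-24833) until rung 0 closes; arithmetic bookkeeping, count-neutral until (E1) consumes it; REL ≠ ★ ≠ WRITTEN ≠ BUILT.

## References
* [Macdonald1971] I. G. Macdonald, *Spherical Functions on a Group of p-adic Type* (1971), Ch. V §3.
* [Serre1980Trees] J.-P. Serre, *Trees* (1980), I.6.4 Prop. 24.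
-/

set_option autoImplicit false
-- the mandated namespace repeats the single-problem summit's segment (`HodgeConjecture.HodgeConjecture`)
set_option linter.dupNamespace false

namespace Summit.HodgeConjecture.HodgeConjecture.R90.S6

/-! ## (AR.0) The G-side closed value: `G(m+2) = q⁴ G(m)` -/

/-- **(AR.0)** The G-side closed value `(if m even then q^{2m−3} N′₁ else q^{2(m−1)} N′₀)` (K2E3-p28's G3-NUMBERS display) obeys the two-step recursion
`G(m+2) = q⁴ · G(m)` for `m ≥ 1`. [cite: Macdonald1971, Ch. V §3] -/
theorem gClosed_two_step (q N₀' N₁' : ℕ) (m : ℕ) (hm : 1 ≤ m) :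
    (if Even (m + 2) then (q : ℂ) ^ (2 * (m + 2) - 3) * (N₁' : ℂ) else (q : ℂ) ^ (2 * ((m + 2) - 1)) * (N₀' : ℂ)) =
      (q : ℂ) ^ 4 * (if Even m then (q : ℂ) ^ (2 * m - 3) * (N₁' : ℂ) else (q : ℂ) ^ (2 * (m - 1)) * (N₀' : ℂ)) := by
  have he2 : Even (m + 2) ↔ Even m := by simp [Nat.even_add]
  rcases Nat.even_or_odd m with hev | hodd
  · -- `m` even, hence `m ≥ 2`
    have hm2 : 2 ≤ m := by
      obtain ⟨k, hk⟩ := hev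
      omega
    rw [if_pos (he2.2 hev), if_pos hev, ← mul_assoc, ← pow_add]
    congr 2
    omega
  · have hne : ¬ Even m := Nat.not_even_iff_odd.2 hodd
    rw [if_neg (fun h => hne (he2.1 h)), if_neg hne, ← mul_assoc, ← pow_add]
    congr 2
    omega

/-! ## (AR.1) The H-side closed form: `RHS(m+2) = q⁴ RHS(m) + (−1)^m (q²−1) q^{2m+1} (N_{[m]} − N_{[m+1]})` -/

/-- **(AR.1)** The H-side closed form `RHS(m)` of ★ `sum_xiHCoeff_mul_shell_eq` (bytes :53–:55) satisfies, for `m ≥ 1`,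
`RHS(m+2) = q⁴ · RHS(m) + (−1)^m (q²−1) q^{2m+1} (N_{[m]} − N_{[m+1]})`, `N_{[k]} = N₁` (`k` even) ∕ `N₀` (`k` odd). [cite: Macdonald1971, Ch. V §3] [cite: Serre1980Trees, I.6.4 Prop. 24] -/
theorem hClosed_two_step (q F₀ N₀ N₁ : ℕ) (m : ℕ) (hm : 1 ≤ m) :
    ((q : ℂ) ^ 2 - 1) * (q : ℂ) ^ (2 * (m + 2 - 1)) * F₀ +
        ((q : ℂ) ^ 2 - 1) * (q : ℂ) ^ (2 * (m + 2) - 3) * (∑ k ∈ Finset.Ico 1 (m + 2), (-1 : ℂ) ^ k * (if Even k then (N₁ : ℂ) else (N₀ : ℂ))) +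
        (-1 : ℂ) ^ (m + 2) * (q : ℂ) ^ (2 * (m + 2) - 1) * (if Even (m + 2) then (N₁ : ℂ) else (N₀ : ℂ)) =
      (q : ℂ) ^ 4 * (((q : ℂ) ^ 2 - 1) * (q : ℂ) ^ (2 * (m - 1)) * F₀ +
        ((q : ℂ) ^ 2 - 1) * (q : ℂ) ^ (2 * m - 3) * (∑ k ∈ Finset.Ico 1 m, (-1 : ℂ) ^ k * (if Even k then (N₁ : ℂ) else (N₀ : ℂ))) +
        (-1 : ℂ) ^ m * (q : ℂ) ^ (2 * m - 1) * (if Even m then (N₁ : ℂ) else (N₀ : ℂ))) +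
      (-1 : ℂ) ^ m * ((q : ℂ) ^ 2 - 1) * (q : ℂ) ^ (2 * m + 1) * ((if Even m then (N₁ : ℂ) else (N₀ : ℂ)) - (if Even (m + 1) then (N₁ : ℂ) else (N₀ : ℂ))) := by
  -- exponent bookkeeping (`m ≥ 1`)
  have hA : (q : ℂ) ^ (2 * (m + 2 - 1)) = (q : ℂ) ^ 4 * (q : ℂ) ^ (2 * (m - 1)) := by
    rw [← pow_add]; congr 1; omega
  have hC : (q : ℂ) ^ (2 * (m + 2) - 1) = (q : ℂ) ^ 4 * (q : ℂ) ^ (2 * m - 1) := by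
    rw [← pow_add]; congr 1; omega
  have hB : (q : ℂ) ^ (2 * (m + 2) - 3) = (q : ℂ) ^ (2 * m + 1) := by
    rw [show 2 * (m + 2) - 3 = 2 * m + 1 by omega]
  -- the middle sum at `m + 2`: split off the terms `k = m` and `k = m + 1`
  have hsum : ∑ k ∈ Finset.Ico 1 (m + 2), (-1 : ℂ) ^ k * (if Even k then (N₁ : ℂ) else (N₀ : ℂ)) =
      ∑ k ∈ Finset.Ico 1 m, (-1 : ℂ) ^ k * (if Even k then (N₁ : ℂ) else (N₀ : ℂ)) +
        (-1 : ℂ) ^ m * (if Even m then (N₁ : ℂ) else (N₀ : ℂ)) + (-1 : ℂ) ^ (m + 1) * (if Even (m + 1) then (N₁ : ℂ) else (N₀ : ℂ)) := by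
    rw [Finset.sum_Ico_succ_top (by omega : 1 ≤ m + 1), Finset.sum_Ico_succ_top hm]
  -- `q⁴ · (q^{2m−3} Σ_{k<m}) = q^{2m+1} Σ_{k<m}` (the sum is empty when `m = 1`)
  have hBm : (q : ℂ) ^ 4 * ((q : ℂ) ^ (2 * m - 3) * ∑ k ∈ Finset.Ico 1 m, (-1 : ℂ) ^ k * (if Even k then (N₁ : ℂ) else (N₀ : ℂ))) =
      (q : ℂ) ^ (2 * m + 1) * ∑ k ∈ Finset.Ico 1 m, (-1 : ℂ) ^ k * (if Even k then (N₁ : ℂ) else (N₀ : ℂ)) := by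
    by_cases hm2 : 2 ≤ m
    · have h41 : (q : ℂ) ^ (2 * m + 1) = (q : ℂ) ^ 4 * (q : ℂ) ^ (2 * m - 3) := by
        rw [← pow_add]; congr 1; omega
      rw [h41, mul_assoc]
    · have hm1 : m = 1 := by omega
      subst hm1
      simp
  -- parities
  have he2 : Even (m + 2) ↔ Even m := by simp [Nat.even_add]
  have hX2 : (if Even (m + 2) then (N₁ : ℂ) else (N₀ : ℂ)) = (if Even m then (N₁ : ℂ) else (N₀ : ℂ)) := by
    by_cases h : Even m
    · rw [if_pos h, if_pos (he2.2 h)]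
    · rw [if_neg h, if_neg (fun h' => h (he2.1 h'))]
  have hneg2 : (-1 : ℂ) ^ (m + 2) = (-1 : ℂ) ^ m := by rw [pow_add, neg_one_sq, mul_one]
  have hneg1 : (-1 : ℂ) ^ (m + 1) = -(-1 : ℂ) ^ m := by rw [pow_succ, mul_neg_one]
  rw [hsum, hA, hC, hB, hX2, hneg2, hneg1]
  linear_combination ((q : ℂ) ^ 2 - 1) * hBm.symm

/-! ## (AR.2) Two-step induction -/

/-- **(AR.2)** Two sequences with the same two-step recursion `X(m+2) = c · X(m)` (`m ≥ 1`) and the same values at `m = 1, 2` agree for every `m ≥ 1`. [folklore] -/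
theorem eq_of_two_step_rec {L R : ℕ → ℂ} {c : ℂ} (hL : ∀ m, 1 ≤ m → L (m + 2) = c * L m) (hR : ∀ m, 1 ≤ m → R (m + 2) = c * R m)
    (h1 : L 1 = R 1) (h2 : L 2 = R 2) : ∀ m, 1 ≤ m → L m = R m := by
  -- strong induction on `m`
  intro m
  induction m using Nat.strong_induction_on with
  | _ m ih =>
    intro hm
    rcases Nat.lt_or_ge m 3 with hlt | hge
    · interval_cases m
      · exact h1
      · exact h2
    · obtain ⟨n, rfl⟩ : ∃ n, m = n + 2 := ⟨m - 2, by omega⟩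
      have hn : 1 ≤ n := by omega
      rw [hL n hn, hR n hn, ih n (by omega) hn]

/-! ## (AR.3) HEAD: the type-(1) elliptic identity for all `m ≥ 1` from the anchors `m = 1, 2` and the first-shell balance -/

/-- **(AR.3) — THE TYPE-(1) ELLIPTIC IDENTITY FROM ITS ANCHORS.**  Let `G : ℕ → ℂ` satisfy `G(m+2) = q⁴ G(m)` (`m ≥ 1`; the G side, (AR.0)), and let two H-side parameter
sets `(F₀ⱼ, N₀ⱼ, N₁ⱼ)`, `j = 1, 2`, satisfy the first-shell balance `N₀₁ + N₀₂ = N₁₁ + N₁₂` (the `D = 0` of the (E1) sheet, from the type-swap symmetry).  If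
`G(1) = RHS₁(1) + RHS₂(1)` and `G(2) = RHS₁(2) + RHS₂(2)`, then `G(m) = RHS₁(m) + RHS₂(m)` for every `m ≥ 1` — by (AR.1) summed over `j` the cross term is
`±(N₀₁ + N₀₂ − N₁₁ − N₁₂) = 0`, so both sides obey `X(m+2) = q⁴ X(m)` and (AR.2) applies. [cite: Macdonald1971, Ch. V §3] [cite: Serre1980Trees, I.6.4 Prop. 24] -/
theorem eq_sum_hClosed_of_anchors (q : ℕ) (G : ℕ → ℂ) (hG : ∀ m, 1 ≤ m → G (m + 2) = (q : ℂ) ^ 4 * G m)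
    (F₀₁ N₀₁ N₁₁ F₀₂ N₀₂ N₁₂ : ℕ) (hD : N₀₁ + N₀₂ = N₁₁ + N₁₂)
    (h1 : G 1 =
      (((q : ℂ) ^ 2 - 1) * (q : ℂ) ^ (2 * (1 - 1)) * F₀₁ +
        ((q : ℂ) ^ 2 - 1) * (q : ℂ) ^ (2 * 1 - 3) * (∑ k ∈ Finset.Ico 1 1, (-1 : ℂ) ^ k * (if Even k then (N₁₁ : ℂ) else (N₀₁ : ℂ))) +
        (-1 : ℂ) ^ 1 * (q : ℂ) ^ (2 * 1 - 1) * (if Even 1 then (N₁₁ : ℂ) else (N₀₁ : ℂ))) +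
      (((q : ℂ) ^ 2 - 1) * (q : ℂ) ^ (2 * (1 - 1)) * F₀₂ +
        ((q : ℂ) ^ 2 - 1) * (q : ℂ) ^ (2 * 1 - 3) * (∑ k ∈ Finset.Ico 1 1, (-1 : ℂ) ^ k * (if Even k then (N₁₂ : ℂ) else (N₀₂ : ℂ))) +
        (-1 : ℂ) ^ 1 * (q : ℂ) ^ (2 * 1 - 1) * (if Even 1 then (N₁₂ : ℂ) else (N₀₂ : ℂ))))
    (h2 : G 2 =
      (((q : ℂ) ^ 2 - 1) * (q : ℂ) ^ (2 * (2 - 1)) * F₀₁ +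
        ((q : ℂ) ^ 2 - 1) * (q : ℂ) ^ (2 * 2 - 3) * (∑ k ∈ Finset.Ico 1 2, (-1 : ℂ) ^ k * (if Even k then (N₁₁ : ℂ) else (N₀₁ : ℂ))) +
        (-1 : ℂ) ^ 2 * (q : ℂ) ^ (2 * 2 - 1) * (if Even 2 then (N₁₁ : ℂ) else (N₀₁ : ℂ))) +
      (((q : ℂ) ^ 2 - 1) * (q : ℂ) ^ (2 * (2 - 1)) * F₀₂ +
        ((q : ℂ) ^ 2 - 1) * (q : ℂ) ^ (2 * 2 - 3) * (∑ k ∈ Finset.Ico 1 2, (-1 : ℂ) ^ k * (if Even k then (N₁₂ : ℂ) else (N₀₂ : ℂ))) +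
        (-1 : ℂ) ^ 2 * (q : ℂ) ^ (2 * 2 - 1) * (if Even 2 then (N₁₂ : ℂ) else (N₀₂ : ℂ)))) :
    ∀ m, 1 ≤ m → G m =
      (((q : ℂ) ^ 2 - 1) * (q : ℂ) ^ (2 * (m - 1)) * F₀₁ +
        ((q : ℂ) ^ 2 - 1) * (q : ℂ) ^ (2 * m - 3) * (∑ k ∈ Finset.Ico 1 m, (-1 : ℂ) ^ k * (if Even k then (N₁₁ : ℂ) else (N₀₁ : ℂ))) +
        (-1 : ℂ) ^ m * (q : ℂ) ^ (2 * m - 1) * (if Even m then (N₁₁ : ℂ) else (N₀₁ : ℂ))) +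
      (((q : ℂ) ^ 2 - 1) * (q : ℂ) ^ (2 * (m - 1)) * F₀₂ +
        ((q : ℂ) ^ 2 - 1) * (q : ℂ) ^ (2 * m - 3) * (∑ k ∈ Finset.Ico 1 m, (-1 : ℂ) ^ k * (if Even k then (N₁₂ : ℂ) else (N₀₂ : ℂ))) +
        (-1 : ℂ) ^ m * (q : ℂ) ^ (2 * m - 1) * (if Even m then (N₁₂ : ℂ) else (N₀₂ : ℂ))) := by
  -- the balance kills the cross term for either parity of `m`
  have hDℂ : (N₀₁ : ℂ) + (N₀₂ : ℂ) = (N₁₁ : ℂ) + (N₁₂ : ℂ) := by exact_mod_cast hD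
  have hcross : ∀ m : ℕ,
      ((if Even m then (N₁₁ : ℂ) else (N₀₁ : ℂ)) - (if Even (m + 1) then (N₁₁ : ℂ) else (N₀₁ : ℂ))) +
        ((if Even m then (N₁₂ : ℂ) else (N₀₂ : ℂ)) - (if Even (m + 1) then (N₁₂ : ℂ) else (N₀₂ : ℂ))) = 0 := fun m => by
    rcases Nat.even_or_odd m with hev | hodd
    · have hne : ¬ Even (m + 1) := Nat.even_add_one.not.2 (not_not.2 hev)
      rw [if_pos hev, if_pos hev, if_neg hne, if_neg hne]
      linear_combination -hDℂ
    · have hne : ¬ Even m := Nat.not_even_iff_odd.2 hodd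
      have hev : Even (m + 1) := hodd.add_one
      rw [if_neg hne, if_neg hne, if_pos hev, if_pos hev]
      linear_combination hDℂ
  -- both sides obey the two-step recursion with `c = q⁴`
  refine eq_of_two_step_rec (c := (q : ℂ) ^ 4) hG (fun m hm => ?_) h1 h2
  have e₁ := hClosed_two_step q F₀₁ N₀₁ N₁₁ m hm
  have e₂ := hClosed_two_step q F₀₂ N₀₂ N₁₂ m hm
  linear_combination e₁ + e₂ + (-1 : ℂ) ^ m * ((q : ℂ) ^ 2 - 1) * (q : ℂ) ^ (2 * m + 1) * hcross m

end Summit.HodgeConjecture.HodgeConjecture.R90.S6
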